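import Summits.ResolutionOfSingularities.ResolutionOfSingularities.Theorems.WeightedInvariantIota3TauDescentDoorAdm
import HarnessLib

/-!
# (desc-τ), item (ADAPT-adm): the FIRST-ORDER STEP — a primitive representative of a pair over the discrete valuation ring `T ⧸ P₀`
# (door `HypersurfaceCentreConstruction`, stmt-ResolutionOfSingularities-19897; gap (1) (desc-τ), memo TAU-DESCENT-A.md §7 step (i))

Topic: `Summits/ResolutionOfSingularities/ResolutionOfSingularities/Theorems`. Helper for the door item `HypersurfaceCentreConstruction`
(stmt-ResolutionOfSingularities-19897, route `WeightedInvariant`), line `local-engine`, def-free.  The remaining item (ADAPT-adm) of (desc-τ) asks for a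
regular-system-of-parameters member `Y₀ = a u + b v` of `T` whose image in `T_{P₀}` is, to first order, a unit multiple of the Abramovich–Quek–Schober order
variable `y₁`; after clearing denominators `s·y₁ = t₁ u + t₂ v` (`tᵢ ∈ T`), this is the following statement about the discrete valuation ring `D = T ⧸ P₀`:

* **`Iota3.exists_primitive_pair_mod`** — in a local ring `T` with a prime `P` such that `T ⧸ P` is a regular local ring of dimension one, for `t₁, t₂ ∈ T` not
  both in `P` there are `z₀ ∉ P`, `n : ℕ` and `a₁, a₂ ∈ T`, NOT BOTH IN `𝔪_T`, with `tᵢ ≡ z₀ⁿ aᵢ (mod P)` — factor the pair `(t̄₁, t̄₂)` in the DVR `T ⧸ P` by the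
  smaller power of a uniformiser.
* `Iota3.sub_mem_sq_of_primitive_pair` — consequently `t₁ u + t₂ v − z₀ⁿ (a₁ u + a₂ v) ∈ P·(u, v)` for any `u, v`.

[OURS · L1 W4.3 · (desc-τ) (ADAPT-adm) first-order step]  Replaces the role of NO printed item; NOT a statement of the manuscript under review
[claim: Hironaka2017, status: under-review]; AI work, weaker than expert review.  No definition; no axiom.

## References

* H. Matsumura, *Commutative Ring Theory* (1986), Thm. 11.2 (structure of discrete valuation rings). [Matsumura1987]
-/

noncomputable section

set_option linter.dupNamespace false -- mandated namespace `Summit.<Summit>.<Problem>` of this single-conjunct summit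

open IsLocalRing Literature.AlgebraicGeometry.Resolution

namespace Summit.ResolutionOfSingularities.ResolutionOfSingularities.Cruxes.HypersurfaceCentreConstruction.LocalEngine

namespace Iota3

/-- In a DVR, a nonzero element is `unit · ϖⁿ`; we record the exponent and the unit. [cite: Matsumura1987, Thm. 11.2] -/
theorem exists_unit_mul_pow_of_ne_zero {D : Type} [CommRing D] [IsDomain D] [IsDiscreteValuationRing D] {ϖ : D} (hϖ : Irreducible ϖ)
    {x : D} (hx : x ≠ 0) : ∃ (n : ℕ) (w : D), IsUnit w ∧ x = w * ϖ ^ n := by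
  obtain ⟨n, u, hu⟩ := IsDiscreteValuationRing.eq_unit_mul_pow_irreducible hx hϖ
  exact ⟨n, u, u.isUnit, hu⟩

/-- **PRIMITIVE REPRESENTATIVE OF A PAIR MODULO A REGULAR CURVE.**  `T` local, `P` an ideal with `T ⧸ P` a regular local ring of dimension one; for
`t₁, t₂ ∈ T` not both in `P` there are `z₀ ∉ P`, `n` and `a₁, a₂` not both in `𝔪_T` with `tᵢ - z₀ⁿ aᵢ ∈ P`. [cite: Matsumura1987, Thm. 11.2] -/
theorem exists_primitive_pair_mod {T : Type} [CommRing T] [IsLocalRing T] (P : Ideal T) [hreg : IsRegularLocalRing (T ⧸ P)]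
    (hP1 : ringKrullDim (T ⧸ P) = 1) {t₁ t₂ : T} (ht : ¬ (t₁ ∈ P ∧ t₂ ∈ P)) :
    ∃ (z₀ : T) (n : ℕ) (a₁ a₂ : T), z₀ ∉ P ∧ ¬ (a₁ ∈ maximalIdeal T ∧ a₂ ∈ maximalIdeal T) ∧
      t₁ - z₀ ^ n * a₁ ∈ P ∧ t₂ - z₀ ^ n * a₂ ∈ P := by
  classical
  haveI := isDomain_of_isRegularLocalRing (T ⧸ P)
  haveI : IsDiscreteValuationRing (T ⧸ P) :=
    Literature.RingTheory.RegularLocalRing.isDiscreteValuationRing_of_ringKrullDim_eq_one hP1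
  haveI : IsLocalHom (Ideal.Quotient.mk P) := IsLocalHom.of_surjective _ Ideal.Quotient.mk_surjective
  obtain ⟨ϖ, hϖ⟩ := IsDiscreteValuationRing.exists_irreducible (T ⧸ P)
  obtain ⟨z₀, hz₀⟩ := Ideal.Quotient.mk_surjective ϖ
  have hz₀P : z₀ ∉ P := fun h => hϖ.ne_zero (by rw [← hz₀, Ideal.Quotient.eq_zero_iff_mem.mpr h])
  -- residue of a unit of `T ⧸ P` lifts outside `𝔪_T`
  have hlift : ∀ w : T ⧸ P, IsUnit w → ∃ a : T, a ∉ maximalIdeal T ∧ Ideal.Quotient.mk P a = w := by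
    intro w hw
    obtain ⟨a, rfl⟩ := Ideal.Quotient.mk_surjective w
    exact ⟨a, fun ha => (IsLocalRing.mem_maximalIdeal _).mp ha (isUnit_of_map_unit (Ideal.Quotient.mk P) a hw), rfl⟩
  -- congruence bookkeeping
  have hcongr : ∀ (t a : T) (n : ℕ), Ideal.Quotient.mk P t = Ideal.Quotient.mk P a * ϖ ^ n → t - z₀ ^ n * a ∈ P := by
    intro t a n h
    rw [← Ideal.Quotient.eq, map_mul, map_pow, hz₀, mul_comm]
    exact h
  by_cases h₁ : t₁ ∈ P
  · -- then `t₂ ∉ P`: factor `t̄₂ = w ϖⁿ`, take `a₁ = z₀^? …` : simply `a₁ := 0`-free choice `t₁ ≡ z₀ⁿ · a₁` with `a₁` chosen from `t̄₁ = 0`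
    have h₂ : t₂ ∉ P := fun h => ht ⟨h₁, h⟩
    have ht₂ : Ideal.Quotient.mk P t₂ ≠ 0 := fun h => h₂ (Ideal.Quotient.eq_zero_iff_mem.mp h)
    obtain ⟨n, w, hw, hwn⟩ := exists_unit_mul_pow_of_ne_zero hϖ ht₂
    obtain ⟨a₂, ha₂, rfl⟩ := hlift w hw
    refine ⟨z₀, n, 0, a₂, hz₀P, fun h => ha₂ h.2, ?_, hcongr t₂ a₂ n hwn⟩
    rw [mul_zero, sub_zero]; exact h₁
  by_cases h₂ : t₂ ∈ P
  · have ht₁ : Ideal.Quotient.mk P t₁ ≠ 0 := fun h => h₁ (Ideal.Quotient.eq_zero_iff_mem.mp h)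
    obtain ⟨n, w, hw, hwn⟩ := exists_unit_mul_pow_of_ne_zero hϖ ht₁
    obtain ⟨a₁, ha₁, rfl⟩ := hlift w hw
    refine ⟨z₀, n, a₁, 0, hz₀P, fun h => ha₁ h.1, hcongr t₁ a₁ n hwn, ?_⟩
    rw [mul_zero, sub_zero]; exact h₂
  -- both nonzero modulo `P`: factor by the smaller exponent
  have ht₁ : Ideal.Quotient.mk P t₁ ≠ 0 := fun h => h₁ (Ideal.Quotient.eq_zero_iff_mem.mp h)
  have ht₂ : Ideal.Quotient.mk P t₂ ≠ 0 := fun h => h₂ (Ideal.Quotient.eq_zero_iff_mem.mp h)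
  obtain ⟨n₁, w₁, hw₁, hwn₁⟩ := exists_unit_mul_pow_of_ne_zero hϖ ht₁
  obtain ⟨n₂, w₂, hw₂, hwn₂⟩ := exists_unit_mul_pow_of_ne_zero hϖ ht₂
  obtain ⟨b₁, hb₁, hb₁w⟩ := hlift w₁ hw₁
  obtain ⟨b₂, hb₂, hb₂w⟩ := hlift w₂ hw₂
  rcases le_total n₁ n₂ with hle | hle
  · -- `n = n₁`, `a₁ = b₁`, `a₂ = b₂ z₀^{n₂ - n₁}`
    refine ⟨z₀, n₁, b₁, b₂ * z₀ ^ (n₂ - n₁), hz₀P, fun h => hb₁ h.1, hcongr t₁ b₁ n₁ (by rw [hb₁w]; exact hwn₁), hcongr t₂ _ n₁ ?_⟩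
    rw [map_mul, map_pow, hz₀, hb₂w, hwn₂, mul_assoc, ← pow_add, Nat.sub_add_cancel hle]
  · refine ⟨z₀, n₂, b₁ * z₀ ^ (n₁ - n₂), b₂, hz₀P, fun h => hb₂ h.2, hcongr t₁ _ n₂ ?_, hcongr t₂ b₂ n₂ (by rw [hb₂w]; exact hwn₂)⟩
    rw [map_mul, map_pow, hz₀, hb₁w, hwn₁, mul_assoc, ← pow_add, Nat.sub_add_cancel hle]

/-- **The first-order adaptation**: with the data of `exists_primitive_pair_mod`, `t₁ u + t₂ v - z₀ⁿ (a₁ u + a₂ v) ∈ P · (u, v)`. [folklore] -/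
theorem sub_mem_mul_of_primitive_pair {T : Type} [CommRing T] {P : Ideal T} {t₁ t₂ z₀ a₁ a₂ : T} {n : ℕ}
    (h₁ : t₁ - z₀ ^ n * a₁ ∈ P) (h₂ : t₂ - z₀ ^ n * a₂ ∈ P) (u v : T) :
    t₁ * u + t₂ * v - z₀ ^ n * (a₁ * u + a₂ * v) ∈ P * Ideal.span {u, v} := by
  have hu : u ∈ Ideal.span ({u, v} : Set T) := Ideal.subset_span (Set.mem_insert _ _)
  have hv : v ∈ Ideal.span ({u, v} : Set T) := Ideal.subset_span (Set.mem_insert_of_mem _ (Set.mem_singleton _))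
  have : t₁ * u + t₂ * v - z₀ ^ n * (a₁ * u + a₂ * v) = (t₁ - z₀ ^ n * a₁) * u + (t₂ - z₀ ^ n * a₂) * v := by ring
  rw [this]
  exact Ideal.add_mem _ (Ideal.mul_mem_mul h₁ hu) (Ideal.mul_mem_mul h₂ hv)

end Iota3

end Summit.ResolutionOfSingularities.ResolutionOfSingularities.Cruxes.HypersurfaceCentreConstruction.LocalEngine

end
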